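import Summits.QuantumFields.QCD.Theses.WilsonMobilityGap
import Literature.Barriers.QuantumFields.WilsonDeterminantSign

/-!
# Crux `MobilityGap` (stmt-QuantumFields-9150), line `Ideator6Sketch`, stub `stub_valencePinch` (S1b) —
# the valence integer pinch REDUCED TO ITS PLATEAU INDEX (the exact shape of the block)

The registered stub `stub_valencePinch` (pocket fractional-moment bound ⇒ no valence fractional-moment
bound uniform over `m₀ ∈ [-1, 1]`, under every phase-quenched sea `x ∈ [-1,1]` at weak coupling) is the
reweighted, sea-uniform twin of the open crux `IntegerCriticalLine.CriticalLineExists`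
(stmt-QuantumFields-9692).  Its intended proof is the plateau principle: an INTEGER-valued index of the
valence family `m₀ ↦ Γ₅ D_W(U, m₀, 1)` over the fixed reweighted link law (the disorder-averaged second
Chern number of the Fermi projection; Aizenman–Graf 1998, Prodan–Schulz-Baldes 2016 Thm 6.5.1 /
Cor 6.5.2, Germinet–Klein–Schenker 2007), CONSTANT along every `m₀`-interval carrying a uniform
fractional-moment bound, equal to `-3` in the doubler pocket and to `0` on the trivial plateau
(Golterman–Jansen–Kaplan 1993 free values; the trivial plateau is pathwise gapped —
`MobilityGapPinch.valence_trivialPlateau_fm`, landed).  None of this index machinery exists in the tree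
or in Mathlib (`Literature/…/TopologicalCriticalMass.lean` takes an abstract `ch : ℝ → ℤ` and its
constancy as hypotheses).

This file isolates the real-line logic: `valencePinch_of_plateauIndex` proves the stub's statement
VERBATIM from its registered hypothesis plus ONE extra hypothesis — the existence, at every weak
coupling and every sea mass `x ∈ [-1,1]`, of an integer assignment `ch : ℝ → ℤ` with `ch(-3/2) = -3`,
`ch(1) = 0`, constant on every interval `[lo, hi]` on which the stub's reweighted valence
fractional-moment bound holds uniformly.  The two intervals `[-3/2,-1]` (hypothesis) and `[-1,1]` (to be
refuted) share the mass `m₀ = -1`, so no gluing of fractional-moment bounds is needed: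
`-3 = ch(-3/2) = ch(-1) = ch(1) = 0`.  What separates the stub from a proof is exactly that extra
hypothesis (the plateau principle for the reweighted Wilson link law), stated here in the skeleton's own
currency.  Pure theorem file (no definitions).
-/

noncomputable section

namespace Summit.QuantumFields.QCD.Theorems.MobilityGapPinch

open scoped BigOperators Topology
open MeasureTheory Filter Set Matrix Complex
open Literature.MathematicalPhysics.QuantumFieldTheory Literature.MathematicalPhysics.QuantumLattice
  Literature.Probability.LatticeModels Literature.Barriers.QuantumFields.WilsonDeterminant

/-- **The valence integer pinch, modulo the plateau index.**  For `N_f ∈ {2,3}`: the pocket plateau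
(hypothesis of `stub_valencePinch`, verbatim) together with a PLATEAU INDEX — at every coupling
`β ≥ β₂` and every sea mass `x ∈ [-1,1]` an integer assignment `ch : ℝ → ℤ` with `ch(-3/2) = -3`,
`ch(1) = 0`, constant on every valence-mass interval `[lo, hi]` carrying the stub's reweighted valence
fractional-moment bound uniformly — imply the conclusion of `stub_valencePinch` verbatim (no valence
fractional-moment bound uniform over `m₀ ∈ [-1, 1]` at `β ≥ max β₁ β₂`).  The index hypothesis is the
unformalised plateau principle (Prodan–Schulz-Baldes 2016, Thm 6.5.1 / Cor 6.5.2) with the free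
values; the proof here is the two-interval pinch at the shared mass `m₀ = -1`. [folklore] -/
theorem valencePinch_of_plateauIndex : ∀ Nf : ℕ, Nf = 2 ∨ Nf = 3 → (∃ β₁ : ℝ, ∀ β : ℝ, β₁ ≤ β → ∀ x : ℝ, -1 ≤ x → x ≤ 1 → ∃ s E₀ C c : ℝ, 0 < s ∧ s < 1 ∧ 0 < E₀ ∧ 0 < c ∧ ∀ m₀ : ℝ, -3 / 2 ≤ m₀ → m₀ ≤ -1 → ∀ (S : ℕ) (E η : ℝ), |E| ≤ E₀ → 0 < η → ∀ v : Fin 4 → ℤ, (∀ i, |v i| ≤ S) → ∀ (a b : Fin 3) (α γ : Fin 4), (∫ U : GaugeConfig 4 (2 * S + 1) (Matrix.specialUnitaryGroup (Fin 3) ℂ), ‖fermionDet (wilsonDirac (fundamentalRep (Fin 3)) U x 1)‖ ^ Nf * ‖(hermitianWilsonDirac (fundamentalRep (Fin 3)) U m₀ 1 - ((E : ℂ) + (η : ℂ) * Complex.I) • (1 : Matrix (TorusSite 4 (2 * S + 1) × Fin 3 × Fin 4) (TorusSite 4 (2 * S + 1) × Fin 3 × Fin 4) ℂ))⁻¹ ((0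 : TorusSite 4 (2 * S + 1)), a, α) (Torus.proj (2 * S + 1) v, b, γ)‖ ^ s ∂(wilsonMeasure (d := 4) (L := 2 * S + 1) (fundamentalRep (Fin 3)) β)) / (∫ U : GaugeConfig 4 (2 * S + 1) (Matrix.specialUnitaryGroup (Fin 3) ℂ), ‖fermionDet (wilsonDirac (fundamentalRep (Fin 3)) U x 1)‖ ^ Nf ∂(wilsonMeasure (d := 4) (L := 2 * S + 1) (fundamentalRep (Fin 3)) β)) ≤ C * Real.exp (-(c * ∑ i, |(v i : ℝ)|))) → (∃ β₂ : ℝ, ∀ β : ℝ, β₂ ≤ β → ∀ x : ℝ, -1 ≤ x → x ≤ 1 → ∃ ch : ℝ → ℤ, ch (-3 / 2) = -3 ∧ ch 1 = 0 ∧ ∀ lo hi : ℝ, (∃ s E₀ C c : ℝ, 0 < s ∧ s < 1 ∧ 0 < E₀ ∧ 0 < c ∧ ∀ m₀ : ℝ, lo ≤ m₀ → m₀ ≤ hi → ∀ (S : ℕ) (E η : ℝ), |E| ≤ E₀ → 0 < η → ∀ v : Fin 4 → ℤ, (∀ i, |v i| ≤ S) → ∀ (a b : Fin 3) (α γ : Fin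 4), (∫ U : GaugeConfig 4 (2 * S + 1) (Matrix.specialUnitaryGroup (Fin 3) ℂ), ‖fermionDet (wilsonDirac (fundamentalRep (Fin 3)) U x 1)‖ ^ Nf * ‖(hermitianWilsonDirac (fundamentalRep (Fin 3)) U m₀ 1 - ((E : ℂ) + (η : ℂ) * Complex.I) • (1 : Matrix (TorusSite 4 (2 * S + 1) × Fin 3 × Fin 4) (TorusSite 4 (2 * S + 1) × Fin 3 × Fin 4) ℂ))⁻¹ ((0 : TorusSite 4 (2 * S + 1)), a, α) (Torus.proj (2 * S + 1) v, b, γ)‖ ^ s ∂(wilsonMeasure (d := 4) (L := 2 * S + 1) (fundamentalRep (Fin 3)) β)) / (∫ U : GaugeConfig 4 (2 * S + 1) (Matrix.specialUnitaryGroup (Fin 3) ℂ), ‖fermionDet (wilsonDirac (fundamentalRep (Fin 3)) U x 1)‖ ^ Nf ∂(wilsonMeasure (d := 4) (L := 2 * S + 1) (fundamentalRep (Fin 3)) β)) ≤ C * Real.exp (-(c * ∑ i, |(v i : ℝ)|))) → ∀ m : ℝ, lo ≤ m → m ≤ hi → ch m = ch lo) → ∃ β₁ : ℝ, ∀ β :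 ℝ, β₁ ≤ β → ∀ x : ℝ, -1 ≤ x → x ≤ 1 → ¬ ∃ s E₀ C c : ℝ, 0 < s ∧ s < 1 ∧ 0 < E₀ ∧ 0 < c ∧ ∀ m₀ : ℝ, -1 ≤ m₀ → m₀ ≤ 1 → ∀ (S : ℕ) (E η : ℝ), |E| ≤ E₀ → 0 < η → ∀ v : Fin 4 → ℤ, (∀ i, |v i| ≤ S) → ∀ (a b : Fin 3) (α γ : Fin 4), (∫ U : GaugeConfig 4 (2 * S + 1) (Matrix.specialUnitaryGroup (Fin 3) ℂ), ‖fermionDet (wilsonDirac (fundamentalRep (Fin 3)) U x 1)‖ ^ Nf * ‖(hermitianWilsonDirac (fundamentalRep (Fin 3)) U m₀ 1 - ((E : ℂ) + (η : ℂ) * Complex.I) • (1 : Matrix (TorusSite 4 (2 * S + 1) × Fin 3 × Fin 4) (TorusSite 4 (2 * S + 1) × Fin 3 × Fin 4) ℂ))⁻¹ ((0 : TorusSite 4 (2 * S + 1)), a, α) (Torus.proj (2 * S + 1) v, b, γ)‖ ^ s ∂(wilsonMeasure (d := 4) (L := 2 * S + 1) (fundamentalRep (Fin 3)) β)) / (∫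 U : GaugeConfig 4 (2 * S + 1) (Matrix.specialUnitaryGroup (Fin 3) ℂ), ‖fermionDet (wilsonDirac (fundamentalRep (Fin 3)) U x 1)‖ ^ Nf ∂(wilsonMeasure (d := 4) (L := 2 * S + 1) (fundamentalRep (Fin 3)) β)) ≤ C * Real.exp (-(c * ∑ i, |(v i : ℝ)|)) := by
  rintro Nf - ⟨β₁, hpocket⟩ ⟨β₂, hidx⟩
  refine ⟨max β₁ β₂, fun β hβ x hx₁ hx₂ hFM => ?_⟩
  obtain ⟨ch, hch₁, hch₂, hconst⟩ := hidx β (le_of_max_le_right hβ) x hx₁ hx₂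
  have h₁ : ch (-1) = ch (-3 / 2) :=
    hconst (-3 / 2) (-1) (hpocket β (le_of_max_le_left hβ) x hx₁ hx₂) (-1) (by norm_num) le_rfl
  have h₂ : ch 1 = ch (-1) := hconst (-1) 1 hFM 1 (by norm_num) le_rfl
  rw [h₂, h₁, hch₁] at hch₂
  norm_num at hch₂

end Summit.QuantumFields.QCD.Theorems.MobilityGapPinch

end
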